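import Mathlib
import HarnessLib
import Summits.QuantumFields.YangMills.Theses.PencilRigidity

/-!
# Candidate proof of Stub C · `LatticeReality` of line `sixteen-charts-analytic-kernel`
(crux stmt-QuantumFields-11687, `PencilRigidity.CurvatureKernelBound`) — refuter drefute evidence, NOT a landing
(positive lemmas are the lead's to land under `Theorems/CurvatureKernelBound/…` with `--supports`).

Method: the pinning argument of Disproof.lean §C (`kernel_eq_zero_off_origin`), re-run for the imaginary part of a
complex kernel with the hypothesis available only on REAL off-diagonal bump tensors. Statement of
`latticeReality` below = `def LatticeReality` of the skeleton, verbatim.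
-/

open scoped BigOperators Topology ComplexConjugate SchwartzMap
open Filter Set Function TopologicalSpace MeasureTheory
open Literature.MathematicalPhysics.QuantumLattice Literature.MathematicalPhysics.AQFT
  Literature.MathematicalPhysics.QuantumFieldTheory

noncomputable section

namespace Summit.QuantumFields.YangMills.Cruxes.CurvatureKernelBound.SixteenChartsAnalyticKernel.DrefuteC

/-- `ℝ⁴`. -/
abbrev E4 : Type := EuclideanSpace ℝ (Fin 4)

/-- A real bump as a real Schwartz function. -/
def bumpSchwartzR {c : E4} (b : ContDiffBump c) : 𝓢(E4, ℝ) :=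
  b.hasCompactSupport.toSchwartzMap b.contDiff

@[simp] theorem bumpSchwartzR_apply {c : E4} (b : ContDiffBump c) (x : E4) :
    bumpSchwartzR b x = b x := rfl

/-- The real two-point tensor `g ⊗ h` of two bumps, complexified factorwise. -/
def bumpTensor {c₀ c₁ : E4} (g : ContDiffBump c₀) (h : ContDiffBump c₁) : 𝓢((Fin 2 → E4), ℂ) :=
  SchwartzMap.tensorFin 2 (fun i => ofRealTest (![bumpSchwartzR g, bumpSchwartzR h] i))

theorem isTensorOf_bumpTensor {c₀ c₁ : E4} (g : ContDiffBump c₀) (h : ContDiffBump c₁) :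
    IsTensorOf (bumpTensor g h) (fun i => ofRealTest (![bumpSchwartzR g, bumpSchwartzR h] i)) :=
  isTensorOf_tensorFin _

theorem bumpTensor_apply {c₀ c₁ : E4} (g : ContDiffBump c₀) (h : ContDiffBump c₁)
    (x : Fin 2 → E4) : bumpTensor g h x = ((g (x 0) * h (x 1) : ℝ) : ℂ) := by
  rw [isTensorOf_bumpTensor g h x, Fin.prod_univ_two]
  simp

/-- Supports of the two bumps at distance: the tensor is off-diagonal (verbatim from Disproof §C). -/
theorem isOffDiagonal_bumpTensor {c₀ c₁ : E4} (g : ContDiffBump c₀) (h : ContDiffBump c₁)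
    (hsep : g.rOut + h.rOut < ‖c₀ - c₁‖) : IsOffDiagonal (bumpTensor g h) := by
  refine IsOffDiagonal.of_tsupport_subset ?_
  let S : Set (Fin 2 → E4) :=
    {x | x 0 ∈ Metric.closedBall c₀ g.rOut ∧ x 1 ∈ Metric.closedBall c₁ h.rOut}
  have hS : IsClosed S := by
    have h0 : Continuous fun x : Fin 2 → E4 => x 0 := continuous_apply 0
    have h1 : Continuous fun x : Fin 2 → E4 => x 1 := continuous_apply 1
    exact (Metric.isClosed_closedBall.preimage h0).inter (Metric.isClosed_closedBall.preimage h1)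
  have hsub : Function.support (bumpTensor g h : (Fin 2 → E4) → ℂ) ⊆ S := by
    intro x hx
    rw [Function.mem_support, bumpTensor_apply] at hx
    have hx' : g (x 0) * h (x 1) ≠ 0 := by exact_mod_cast hx
    obtain ⟨hg, hh⟩ := mul_ne_zero_iff.1 hx'
    have hg' : x 0 ∈ Function.support g := hg
    have hh' : x 1 ∈ Function.support h := hh
    rw [ContDiffBump.support_eq] at hg' hh'
    exact ⟨Metric.ball_subset_closedBall hg', Metric.ball_subset_closedBall hh'⟩
  intro x hx hloc
  have hxS : x ∈ S := (closure_minimal hsub hS) hx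
  obtain ⟨i, j, hij, hxij⟩ := hloc
  have h01 : x 0 = x 1 := by
    fin_cases i <;> fin_cases j
    · exact absurd rfl hij
    · exact hxij
    · exact hxij.symm
    · exact absurd rfl hij
  obtain ⟨h0, h1⟩ := hxS
  rw [Metric.mem_closedBall, h01] at h0
  rw [Metric.mem_closedBall] at h1
  have : ‖c₀ - c₁‖ ≤ g.rOut + h.rOut := by
    calc ‖c₀ - c₁‖ = dist c₀ c₁ := (dist_eq_norm _ _).symm
      _ ≤ dist c₀ (x 1) + dist (x 1) c₁ := dist_triangle _ _ _
      _ ≤ g.rOut + h.rOut := by rw [dist_comm] ; exact add_le_add h0 h1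
  linarith

/-- **Pinning on bumps.** A real kernel continuous off `0` whose integrals against all separated real bump
tensors `g ⊗ h` (second bump at the origin) vanish, vanishes off `0`. (Disproof §C, hypothesis weakened to bumps.) -/
theorem kernel_eq_zero_off_origin_of_bumps (K : E4 → ℝ) (hK : ContinuousOn K {x : E4 | x ≠ 0})
    (h0 : ∀ (c : E4) (g : ContDiffBump c) (h : ContDiffBump (0 : E4)), g.rOut + h.rOut < ‖c - 0‖ →
      Integrable (fun x : Fin 2 → E4 => K (x 0 - x 1) * (g (x 0) * h (x 1))) ∧
        ∫ x : Fin 2 → E4, K (x 0 - x 1) * (g (x 0) * h (x 1)) = 0) :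
    ∀ x : E4, x ≠ 0 → K x = 0 := by
  intro x₀ hx₀
  by_contra hne
  set κ := K x₀ with hκdef
  have hκ : 0 < |κ| := abs_pos.2 hne
  have hopen : IsOpen {x : E4 | x ≠ 0} := isOpen_compl_singleton
  have hcont : ContinuousAt K x₀ := (hK x₀ hx₀).continuousAt (hopen.mem_nhds hx₀)
  obtain ⟨ρ, hρ, hρK⟩ := Metric.continuousAt_iff.1 hcont (|κ| / 2) (half_pos hκ)
  have hn0 : 0 < ‖x₀‖ := norm_pos_iff.2 hx₀
  set r : ℝ := min (ρ / 4) (‖x₀‖ / 4) with hrdef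
  have hr : 0 < r := lt_min (by linarith) (by linarith)
  have hrρ : r ≤ ρ / 4 := min_le_left _ _
  have hrx : r ≤ ‖x₀‖ / 4 := min_le_right _ _
  let g : ContDiffBump x₀ := ⟨r / 2, r, by linarith, by linarith⟩
  let h : ContDiffBump (0 : E4) := ⟨r / 2, r, by linarith, by linarith⟩
  have hsep : g.rOut + h.rOut < ‖x₀ - 0‖ := by
    show r + r < ‖x₀ - 0‖; rw [sub_zero]; linarith
  obtain ⟨hintR, hIR⟩ := h0 x₀ g h hsep
  set fR : (Fin 2 → E4) → ℝ := fun x => K (x 0 - x 1) * (g (x 0) * h (x 1)) with hfR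
  -- lower bound ℓ ≤ κ * fR
  set ℓ : (Fin 2 → E4) → ℝ := fun x => κ ^ 2 / 2 * (g (x 0) * h (x 1)) with hℓ
  have hℓ_le : ∀ x, ℓ x ≤ κ * fR x := by
    intro x
    by_cases hgh : g (x 0) * h (x 1) = 0
    · simp [ℓ, fR, hgh]
    obtain ⟨hg1, hh1⟩ := mul_ne_zero_iff.1 hgh
    have hg2 : x 0 ∈ Metric.ball x₀ r := by
      have : x 0 ∈ Function.support g := hg1
      rwa [ContDiffBump.support_eq] at this
    have hh2 : x 1 ∈ Metric.ball (0 : E4) r := by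
      have : x 1 ∈ Function.support h := hh1
      rwa [ContDiffBump.support_eq] at this
    rw [Metric.mem_ball, dist_eq_norm] at hg2 hh2
    rw [sub_zero] at hh2
    have hd : dist (x 0 - x 1) x₀ < ρ := by
      rw [dist_eq_norm]
      calc ‖x 0 - x 1 - x₀‖ = ‖(x 0 - x₀) - x 1‖ := by congr 1; abel
        _ ≤ ‖x 0 - x₀‖ + ‖x 1‖ := norm_sub_le _ _
        _ < r + r := add_lt_add hg2 hh2
        _ ≤ ρ := by linarith
    have hKx := hρK hd
    rw [Real.dist_eq] at hKx
    have hprod : 0 ≤ g (x 0) * h (x 1) := mul_nonneg g.nonneg h.nonneg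
    have hkey : κ ^ 2 / 2 ≤ κ * K (x 0 - x 1) := by
      have h1 : |κ| * |K (x 0 - x 1) - κ| ≤ |κ| * (|κ| / 2) :=
        mul_le_mul_of_nonneg_left hKx.le (abs_nonneg _)
      have h2 : -(|κ| * |K (x 0 - x 1) - κ|) ≤ κ * (K (x 0 - x 1) - κ) := by
        rw [← abs_mul]; exact neg_abs_le _
      have h3 : |κ| * |κ| = κ ^ 2 := by rw [← sq, sq_abs]
      nlinarith
    calc ℓ x = κ ^ 2 / 2 * (g (x 0) * h (x 1)) := rfl
      _ ≤ κ * K (x 0 - x 1) * (g (x 0) * h (x 1)) := mul_le_mul_of_nonneg_right hkey hprod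
      _ = κ * fR x := by simp [fR]; ring
  have hℓ_cont : Continuous ℓ :=
    continuous_const.mul ((g.continuous.comp (continuous_apply 0)).mul
      (h.continuous.comp (continuous_apply 1)))
  have hℓ_supp : HasCompactSupport ℓ := by
    let B : Fin 2 → Set E4 := ![Metric.closedBall x₀ r, Metric.closedBall (0 : E4) r]
    refine HasCompactSupport.intro (K := Set.pi Set.univ B)
      (isCompact_univ_pi fun i => ?_) ?_
    · fin_cases i <;> exact isCompact_closedBall _ _
    · intro x hx
      rw [Set.mem_univ_pi, Fin.forall_fin_two] at hx
      simp only [ℓ]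
      have : g (x 0) * h (x 1) = 0 := by
        by_contra hgh
        obtain ⟨hg1, hh1⟩ := mul_ne_zero_iff.1 hgh
        have hg2 : x 0 ∈ Function.support g := hg1
        have hh2 : x 1 ∈ Function.support h := hh1
        rw [ContDiffBump.support_eq] at hg2 hh2
        exact hx ⟨Metric.ball_subset_closedBall hg2, Metric.ball_subset_closedBall hh2⟩
      rw [this, mul_zero]
  have hℓ_nonneg : 0 ≤ ℓ := fun x => by
    simp only [ℓ, Pi.zero_apply]; exact mul_nonneg (by positivity) (mul_nonneg g.nonneg h.nonneg)
  let xs : Fin 2 → E4 := ![x₀, 0]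
  have hℓ_xs : ℓ xs ≠ 0 := by
    have hg1 : g (xs 0) = 1 := g.one_of_mem_closedBall (by simpa [xs, g] using (half_pos hr).le)
    have hh1 : h (xs 1) = 1 := h.one_of_mem_closedBall (by simpa [xs, h] using (half_pos hr).le)
    simp only [ℓ, hg1, hh1, mul_one]
    positivity
  have hpos : 0 < ∫ x, ℓ x :=
    hℓ_cont.integral_pos_of_hasCompactSupport_nonneg_nonzero hℓ_supp hℓ_nonneg hℓ_xs
  have hle : ∫ x, ℓ x ≤ ∫ x, κ * fR x :=
    integral_mono_of_nonneg (Eventually.of_forall hℓ_nonneg) (hintR.const_mul κ)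
      (Eventually.of_forall hℓ_le)
  have hzero : ∫ x, κ * fR x = 0 := by rw [integral_const_mul, hIR, mul_zero]
  linarith [hle, hzero, hpos]

/-- **Stub C (`LatticeReality`), proved.** Statement verbatim = `def LatticeReality` /
`Stub.LatticeReality` of `Lines/sixteen-charts-analytic-kernel.lean`. -/
theorem latticeReality :
    ∀ (S₁ : SchwingerFamily (EuclideanSpace ℝ (Fin 4))) (K : (EuclideanSpace ℝ (Fin 4)) → ℂ), ContinuousOn K {x : (EuclideanSpace ℝ (Fin 4)) | x ≠ 0} → (∀ F : SchwartzMap (Fin 2 → (EuclideanSpace ℝ (Fin 4))) ℂ, IsOffDiagonal F → MeasureTheory.Integrable (fun x : Fin 2 → (EuclideanSpace ℝ (Fin 4)) => K (x 0 - x 1) * F x) ∧ S₁ 2 F = ∫ x : Fin 2 → (EuclideanSpace ℝ (Fin 4)), K (x 0 - x 1) * F x) → (∀ (f : Fin 2 → SchwartzMap (EuclideanSpace ℝ (Fin 4)) ℝ) (F : SchwartzMap (Fin 2 → (EuclideanSpace ℝ (Fin 4))) ℂ), IsTensorOf F (fun i => ofRealTest (f i)) → IsOffDiagonal F → (S₁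 2 F).im = 0) → ∀ x : (EuclideanSpace ℝ (Fin 4)), x ≠ 0 → (K x).im = 0 := by
  intro S₁ K hK hrep hreal
  -- apply bump pinning to the real kernel `im ∘ K`
  refine kernel_eq_zero_off_origin_of_bumps (fun x => (K x).im)
    (Complex.continuous_im.comp_continuousOn hK) ?_
  intro c g h hsep
  have hoff : IsOffDiagonal (bumpTensor g h) := isOffDiagonal_bumpTensor g h hsep
  obtain ⟨hint, hSF⟩ := hrep (bumpTensor g h) hoff
  have him0 : (S₁ 2 (bumpTensor g h)).im = 0 :=
    hreal (![bumpSchwartzR g, bumpSchwartzR h]) (bumpTensor g h) (isTensorOf_bumpTensor g h) hoff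
  -- the integrand with the bump tensor, and its imaginary part
  have hfun : (fun x : Fin 2 → E4 => K (x 0 - x 1) * bumpTensor g h x) =
      fun x => K (x 0 - x 1) * ((g (x 0) * h (x 1) : ℝ) : ℂ) := by
    funext x; rw [bumpTensor_apply]
  rw [hfun] at hint hSF
  have him_fun : (fun x : Fin 2 → E4 => (K (x 0 - x 1) * ((g (x 0) * h (x 1) : ℝ) : ℂ)).im) =
      fun x => (K (x 0 - x 1)).im * (g (x 0) * h (x 1)) := by
    funext x; simp [Complex.mul_im]
  refine ⟨?_, ?_⟩
  · have := hint.im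
    refine this.congr (Eventually.of_forall fun x => ?_)
    simp
  · have h1 : (∫ x : Fin 2 → E4, K (x 0 - x 1) * ((g (x 0) * h (x 1) : ℝ) : ℂ)).im = 0 := by
      rw [← hSF]; exact him0
    rw [← him_fun, ← h1]
    exact (integral_im hint)

end Summit.QuantumFields.YangMills.Cruxes.CurvatureKernelBound.SixteenChartsAnalyticKernel.DrefuteC
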